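import Literature.Geometry.DiscreteGeometry.DelsarteLinearProgrammingBound

/-!
# The kissing number in dimension 8 is at most 240 (sharp Delsarte LP certificate)

Framing: lottery ticket; floor = certified bounds/negative ranges. Venture `PackingBounds`
(cell `pub-packcert`), kissing-number family, **+ control, dimension 8**.

**Theorem (Odlyzko–Sloane 1979; Levenshtein 1979).** Every finite set of unit vectors of `ℝ⁸`
with pairwise inner products `≤ 1/2` has at most `240` elements (`κ(8) ≤ 240`; the `E₈` root
system shows `κ(8) = 240`). Proof: the linear programming bound
(`Literature.Geometry.DiscreteGeometry.DelsarteLP.card_le`) with the polynomial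
`f(t) = (t+1)(t+1/2)² t² (t-1/2)`, whose Gegenbauer coefficients for `S⁷` (`μ = 3`,
`C_k^{(3)} = gegenbauerSum 3 k`) are
`(f_0,…,f_6) = (3/320, 1/80, 5/448, 39/4480, 19/3840, 1/448, 1/1792)`, all positive, and
`f(1) = 9/4 = 240 · f_0` — the bound is attained exactly (kernel-checked rational identity).
The certificate was generated and checked in exact arithmetic by two independent Gegenbauer
implementations (recurrence / explicit sum, `code/delsarte_exact.py` of the cell) before this
kernel check.

## References
* A. M. Odlyzko, N. J. A. Sloane, J. Combin. Theory Ser. A 26 (1979) 210–214. [`OdlyzkoSloane1979`]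
* V. I. Levenshtein, Soviet Math. Dokl. 20 (1979) 417–421. [`Levenshtein1979`]
* J. H. Conway, N. J. A. Sloane, *Sphere Packings, Lattices and Groups*, Ch. 1 Table 1.5, Ch. 13. [`ConwaySloane1999`]
-/

namespace Summit.Ventures.PackingBounds.Kissing

open Finset Literature.Analysis.SpecialFunctions Literature.Geometry.DiscreteGeometry

/-- **`κ(8) ≤ 240`** (Odlyzko–Sloane 1979, Levenshtein 1979): a finite set of unit vectors of
`ℝ⁸` with pairwise inner products `≤ 1/2` has at most `240` elements. Sharp Delsarte LP
certificate `f(t) = (t+1)(t+1/2)²t²(t-1/2)`, `f(1)/f_0 = 240` exactly.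
[cite: OdlyzkoSloane1979, Theorem (n = 8)] -/
theorem kissing_dim8_le_240 (C : Finset (EuclideanSpace ℝ (Fin 8)))
    (h1 : ∀ x ∈ C, ‖x‖ = 1) (h2 : ∀ x ∈ C, ∀ y ∈ C, x ≠ y → inner ℝ x y ≤ 1 / 2) :
    C.card ≤ 240 := by
  refine DelsarteLP.card_le (n := 8) (μ := 3) (by norm_num) (by norm_num) 6
    (fun k => match k with
      | 0 => 3 / 320 | 1 => 1 / 80 | 2 => 5 / 448 | 3 => 39 / 4480 | 4 => 19 / 3840
      | 5 => 1 / 448 | 6 => 1 / 1792 | _ => 0)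
    ?_ (1 / 2) ?_ 240 (by norm_num) ?_ C h1 h2
  · intro k
    split <;> norm_num
  · intro t ht1 ht2
    have key : (t + 1) * ((t + 1 / 2) ^ 2 * t ^ 2) * (t - 1 / 2) ≤ 0 :=
      mul_nonpos_of_nonneg_of_nonpos
        (mul_nonneg (by linarith) (mul_nonneg (sq_nonneg _) (sq_nonneg _))) (by linarith)
    have hsum : ∑ k ∈ range (6 + 1), (fun k => match k with
        | 0 => 3 / 320 | 1 => 1 / 80 | 2 => 5 / 448 | 3 => 39 / 4480 | 4 => 19 / 3840
        | 5 => 1 / 448 | 6 => 1 / 1792 | _ => 0) k * gegenbauerSum (3 : ℝ) k t =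
        (t + 1) * ((t + 1 / 2) ^ 2 * t ^ 2) * (t - 1 / 2) := by
      simp [Finset.sum_range_succ, gegenbauerSum, gegenbauerCoeff, Finset.prod_range_succ,
        Nat.factorial]
      ring
    rw [hsum]
    exact key
  · norm_num [Finset.sum_range_succ, gegenbauerSum, gegenbauerCoeff, Finset.prod_range_succ,
      Nat.factorial]

end Summit.Ventures.PackingBounds.Kissing
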